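import Summits.QuantumFields.YangMills.Theorems.BalabanUVNodesN12DirectSurjHsurjSupportPrelim
import Summits.QuantumFields.YangMills.Theorems.BalabanUVNodesN12DirectSurjTriangularSupport
import HarnessLib

/-!
# BalabanUVNodes ∕ N12 — (P4)′ SUPPORT EDITION: the right inverse `H` of the chart derivative at a (2.12) minimiser (guarded proxies only, p678596's hypotheses verbatim) RE-ASSEMBLED
# BY LEVEL, with a TRUE support clause `hHsupp″` (closure form) — the (P4)′-side input of the lane census' uniformity item U2b

Cell `pub-ymgap` (HUMAN RULINGS D-0062 ∕ D-0149), WIDTH SEAT `pub-ymgap-dag-n12-w6` g8 (node N12 = [B15]; director-ym R463-ym clone by row N12 (P4): the binders `H ∕ hHinv ∕ hHB ∕ hHsupp` of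
p654775; key K1⁹ `stmt-QuantumFields-27364`, `--kind proof --supports … --as helper`; count-neutral; lane census memo §7 U2b).  THEOREMS ONLY (0 `def`, 0 `instance`, 0 `sorry`).

WHY.  p654775's displayed clause `hHsupp : H v b = 0 off the Ω₁(Z)-sourced bonds` is unsatisfiable with `hHinv` (the level-`0` rows ARE the `Γ₀`-bonds: dag-n08-c p657858), and the
(P4)′ socket of record (p664681 ∕ p678596) says nothing about supports (p660274 hides the preimage behind `Classical.choose`).  What IS true is a `v`-DEPENDENT clause: `H v` lives on the
`Γ₀`-rows charged by `v` and on the block interiors of the inner sites whose rows are charged by `v` OR reached, through their sharp towers, by columns fired at LOWER levels.  This file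
re-runs the (P4)′ assembly with the rows ranked by LEVEL (`k + 1` ranks; the curved site blocks of one level have pairwise disjoint fine supports and are EXACT on every row of their level,
so their SUM solves the level with the same sup-norm letter) over the support-tracking back-substitution `…N12DirectSurjTriangularSupport` (bookkeeping lemmas in `…HsurjSupportPrelim`).

THE SUPPORT CLAUSE `hHsupp″` (exact text, for U2b's (μ) row to key on).  For every target `v` and every LEVEL-GRADED family `𝒮 : ℕ → Set (PBond (F.P K) 0)`:
(a) every level-`0` row `b ∈ bondsOf (𝐁_k(Z) 0)` with `v_b ≠ 0` lies in `𝒮 0`;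
(b) for every level-`j` row `c ∈ bondsOf (𝐁_k(Z) j)`, `1 ≤ j ≤ k`, such that `v_c ≠ 0` OR some `b₀ ∈ 𝒮 m` of a LOWER grade `m < j` lies in the sharp tower of `c` (`B^j(b₀,±) ∈ {c₋, c₊}`),
    and every INNER end-point `y` of `c` (`ι_j y ∈ Ω_j(Z)`): every fine bond `b₀` with `B^j(b₀,−) = B^j(b₀,+) = y` crossing an internal `(j−1)`-face (`B^{j−1}(b₀,−) ≠ B^{j−1}(b₀,+)`)
    lies in `𝒮 j`;
⟹ `H v b = 0` off `⋃ₘ 𝒮 m`.  The grading is ESSENTIAL (dag-n12-c g22's (F3)): towers are read against LOWER grades only, so the least family for `v = e_c` (one level-`j` row) is a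
per-height hull (grades `< j` empty; face bonds of `c`'s inner end-points; then the sites within two blocks of the ancestors), NOT the component of `Γ_j`; lattice count = a sequel.

THE LETTERS.  SUP-NORM letter `‖H v‖ ≤ B‖v‖`, `B = β·(k+1)·(1+Λβ)^{k+1}` (β, Λ as in p664681; exponent = number of LEVELS, no longer `1 + (k+1)·Σ_{j≤k} #Site_j`) AND the socket's ℓ²(HS)
letter `√(Σ_b ‖H v b‖²) ≤ (√#PBond·B)‖v‖`; an ℓ¹ letter over any bond set `𝒯 ⊇ supp (H v)` follows as `#𝒯·B·‖v‖` (dag-n12-c g22's (F2) currency).  `B` is still per instance (`Cp = #PBond`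
inside `Λ`, the sum-over-sites flat-block letter `CΦ`): print's volume-free (46) is NOT claimed.

CONTENTS.  ★★★ `exists_rightInverse_letter_support_of_proxies` — p678596's hypotheses VERBATIM ⟹ `∃ H, hHinv ∧ hHB∞ ∧ hHB ∧ hHsupp″`.

HONEST FRAMING.  Bookkeeping by name over landed kernel theorems; per-height ∕ per-instance EXISTENCE constants; the proxies and the box plaquette letter are HYPOTHESES (produced from the
class by the lane's p677953 ∕ p679665); nothing of Bałaban's asserted or refuted; N12 NOT discharged; K1⁹ NOT closed; count-neutral; R4 closes only the conditional finite-`𝕋⁴` rung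
`BalabanLadder.UV`; no summit statement is proved here and NOT the Yang–Mills mass gap (Clay); nothing continuum ∕ ℝ⁴ ∕ OS.
-/

noncomputable section

open scoped BigOperators Matrix.Norms.L2Operator Topology NNReal
open Filter

namespace Summit.QuantumFields.YangMills.BalabanUVNodes.N12DirectSurjHsurjSupport

open Literature.MathematicalPhysics.QuantumFieldTheory.Balaban1983to89
open Node00 B15DeterminingSets
open T4Continuum (T4Family)
open BlockAveragingEMLLinearised (linAvg)
open T4AdjointCovarianceUnitary (lieSU)
open B14.Eq213DetSet (Bj maxDomT Bj_of_gt)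
open B14.Eq213MaximalDomains (side)
open B14.Eq216Concrete (feeds)
open B5Eq118OneStroke (iterBlockOf)
open B15Eq112TorusCover (lift)
open T4AxialGaugeSmallField (boxPlaqs)
open Summit.QuantumFields.YangMills.BalabanUVNodes.N12DirectSurjTriangularSupport (exists_rightInverse_bound_support_of_rankwise)
open Summit.QuantumFields.YangMills.BalabanUVNodes.N12DirectSurjHsurjSupportPrelim
open Summit.QuantumFields.YangMills.BalabanUVNodes.N12DirectSurjSiteBlockCurved (exists_rowBound exists_curved_siteBlock)
open Summit.QuantumFields.YangMills.BalabanUVNodes.N12DirectSurjBoxGauge (exists_boxGauge)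
open Summit.QuantumFields.YangMills.BalabanUVNodes.N12DirectSurjHsurjPrelim
open Summit.QuantumFields.YangMills.BalabanUVNodes.N12DirectSurjHsurjProxiesPrelim

section Record

variable {F : T4Family} {N : ℕ} [NeZero N] {K k : ℕ}

set_option maxHeartbeats 400000 in
/-- ★★★ **(P4)′, SUPPORT EDITION — A RIGHT INVERSE OF THE CHART DERIVATIVE AT A MINIMISER WITH GUARDED PROXIES, WITH A LETTER AND THE TRUE SUPPORT CLAUSE.**  p678596's
`exists_rightInverse_letter_of_proxies` VERBATIM in its hypotheses and in `DΨ_{𝐁_k(Z),W,U₀}(0) ∘ H = id`, now with the SUP-NORM letter `‖H v‖ ≤ B‖v‖` and the socket's ℓ² letter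
`√(Σ_b ‖H v b‖²) ≤ (√#PBond·B)‖v‖`; PLUS `hHsupp″`: for every `v` and every level-graded family `𝒮` containing (a) in grade `0` the level-`0` rows charged by `v` and (b) in grade `j` the
internal-face bonds of the `j`-blocks of the inner end-points of every level-`j` row (`1 ≤ j ≤ k`) charged by `v` or whose sharp tower meets a LOWER grade of `𝒮`, `H v` vanishes off
`⋃ₘ 𝒮 m`.  Proof: rank := level; a level is solved by the SUM of its curved site blocks (disjoint supports, exact on the level, footprint below) over the support-tracking back-substitution
(row locality = `fderiv_msChart_apply_eq_zero_of_vanish_sharp'`, level-`0` rows = the evaluation). [cite: Balaban1985Variational, (83) p.290, (44)-(47) p.285, (153) p.301;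
Balaban1988Convergent, (2.2) p.255, (2.10)-(2.13) pp.256-257; Balaban1987RG1, (0.4) p.253] -/
theorem exists_rightInverse_letter_support_of_proxies (hkK : k + 1 ≤ (F.P K).m + (F.P K).K) :
    ∃ ε : ℝ, 0 < ε ∧ ∀ (M₁ : ℕ) (_ : 1 ≤ M₁) (Z : Set (Site (F.P K) 0)) (_ : side (F.P K).L M₁ k ∣ (F.P K).sitesPerDir 0),
      ∃ B : ℝ, 0 ≤ B ∧ ∀ (W : MSField (F.P K) (SU N)) (U₀ : GaugeField (F.P K) 0 (SU N)),
        AgreeOn (Bj M₁ Z k) (avgFamily (avOfRecord F N K) U₀) W →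
        (∀ i : Fin (constrCard (Bj M₁ Z k) k), ∃ U' : GaugeField (F.P K) 0 (SU N),
          (∀ b ∈ feeds (((constrEnum (Bj M₁ Z k) k).symm i).1 : ℕ) ((constrEnum (Bj M₁ Z k) k).symm i).2.1, U' b = U₀ b) ∧ SmallBelow (avOfRecord F N K) k U') →
        (∀ (j : ℕ), 1 ≤ j → j ≤ k → ∀ y : Site (F.P K) j, embIter j y ∈ maxDomT M₁ Z j → ∃ U' : GaugeField (F.P K) 0 (SU N),
          (∀ c : PBond (F.P K) j, (c.src = y ∨ c.tgt = y) → ∀ b₀ : PBond (F.P K) 0,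
            (iterBlockOf j b₀.src = c.src ∨ iterBlockOf j b₀.src = c.tgt) → (iterBlockOf j b₀.tgt = c.src ∨ iterBlockOf j b₀.tgt = c.tgt) → U' b₀ = U₀ b₀) ∧
          SmallBelow (avOfRecord F N K) k U') →
        (∀ (j : ℕ), 1 ≤ j → j ≤ k → ∀ y : Site (F.P K) j, embIter j y ∈ maxDomT M₁ Z j →
          PlaqSmallOn (boxPlaqs (P := F.P K) (j := 0)
            (fun κ => lift (F.P K) (embIter j y) κ - ((((F.P K).L ^ j : ℕ) : ℤ) + ((((F.P K).L ^ j - 1) / 2 : ℕ) : ℤ)))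
            (fun κ => lift (F.P K) (embIter j y) κ + ((((F.P K).L ^ j : ℕ) : ℤ) + ((((F.P K).L ^ j - 1) / 2 : ℕ) : ℤ)))) ε U₀) →
        ∃ H : (Fin (constrCard (Bj M₁ Z k) k) → lieSU (Fin N)) → PBond (F.P K) 0 → lieSU (Fin N),
          (∀ v, fderiv ℝ (msChart F N K k (Bj M₁ Z k) W U₀) 0 (H v) = v) ∧
          (∀ v, ‖H v‖ ≤ B * ‖v‖) ∧
          (∀ v, Real.sqrt (∑ b, ‖H v b‖ ^ 2) ≤ (Real.sqrt (Fintype.card (PBond (F.P K) 0)) * B) * ‖v‖) ∧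
          ∀ (v : Fin (constrCard (Bj M₁ Z k) k) → lieSU (Fin N)) (𝒮 : ℕ → Set (PBond (F.P K) 0)),
            (∀ (b : PBond (F.P K) 0) (hb : b ∈ bondsOf (Bj M₁ Z k 0)), v (constrEnum (Bj M₁ Z k) k ⟨⟨0, Nat.succ_pos k⟩, b, hb⟩) ≠ 0 → b ∈ 𝒮 0) →
            (∀ (j : ℕ) (hj : 1 ≤ j) (hjk : j ≤ k) (c : PBond (F.P K) j) (hc : c ∈ bondsOf (Bj M₁ Z k j)),
              (v (constrEnum (Bj M₁ Z k) k ⟨⟨j, Nat.lt_succ_of_le hjk⟩, c, hc⟩) ≠ 0 ∨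
                ∃ m, m < j ∧ ∃ b₀ ∈ 𝒮 m, (iterBlockOf j b₀.src = c.src ∨ iterBlockOf j b₀.src = c.tgt) ∧ (iterBlockOf j b₀.tgt = c.src ∨ iterBlockOf j b₀.tgt = c.tgt)) →
              ∀ y : Site (F.P K) j, (c.src = y ∨ c.tgt = y) → embIter j y ∈ maxDomT M₁ Z j →
              ∀ b₀ : PBond (F.P K) 0, iterBlockOf j b₀.src = y → iterBlockOf j b₀.tgt = y → iterBlockOf (j - 1) b₀.src ≠ iterBlockOf (j - 1) b₀.tgt → b₀ ∈ 𝒮 j) →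
            ∀ b, (∀ m, b ∉ 𝒮 m) → H v b = 0 := by
  classical
  have hk : k ≤ (F.P K).m + (F.P K).K := Nat.le_of_succ_le hkK
  obtain ⟨Q, hQ0, hQs⟩ : ∃ Q : (i : ℕ) → (PBond (F.P K) 0 → Matrix (Fin N) (Fin N) ℂ) → PBond (F.P K) i → Matrix (Fin N) (Fin N) ℂ,
      (∀ Y, Q 0 Y = Y) ∧ ∀ (i : ℕ) (Y : PBond (F.P K) 0 → Matrix (Fin N) (Fin N) ℂ) (c : PBond (F.P K) (i + 1)), Q (i + 1) Y c = linAvg (Q i Y) c :=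
    ⟨fun i => Nat.rec (motive := fun i => (PBond (F.P K) 0 → Matrix (Fin N) (Fin N) ℂ) → PBond (F.P K) i → Matrix (Fin N) (Fin N) ℂ) (fun Y => Y)
      (fun _ Qi Y c => linAvg (Qi Y) c) i, fun _ => rfl, fun _ _ _ => rfl⟩
  obtain ⟨p, Cp, hCp, hp, hpn⟩ := exists_cardSeminorm (F := F) K N
  obtain ⟨C₁, ρ₁, hC₁, hρ₁, hRB⟩ := exists_rowBound (F := F) (N := N) (K := K) k Q hQ0 hQs p hp hCp hpn
  obtain ⟨C₂, ρ₂, hC₂, hρ₂, hblk⟩ := exists_curved_siteBlock (F := F) (N := N) (K := K) k Q hQ0 hQs p hp hCp hpn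
  obtain ⟨Φf, CΦ, hCΦ1, hCΦfn, hΦprops⟩ := exists_flatBlocks_uniform (F := F) (N := N) (K := K) k Q hQ0 hQs
  have hCΦ0 : 0 ≤ CΦ := zero_le_one.trans hCΦ1
  set D : ℝ := (((F.P K).d - 1 : ℕ) : ℝ) * ((2 * ((F.P K).L ^ k + ((F.P K).L ^ k - 1) / 2) : ℕ) : ℝ) with hD_def
  have hD0 : 0 ≤ D := mul_nonneg (Nat.cast_nonneg _) (Nat.cast_nonneg _)
  have hDj : ∀ j ≤ k, (((F.P K).d - 1 : ℕ) : ℝ) * ((2 * ((F.P K).L ^ j + ((F.P K).L ^ j - 1) / 2) : ℕ) : ℝ) ≤ D := fun j hj => by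
    rw [hD_def]
    refine mul_le_mul_of_nonneg_left ?_ (Nat.cast_nonneg _)
    have h1 : (F.P K).L ^ j ≤ (F.P K).L ^ k := Nat.pow_le_pow_right (F.P K).L_pos hj
    have h2 : ((F.P K).L ^ j - 1) / 2 ≤ ((F.P K).L ^ k - 1) / 2 := Nat.div_le_div_right (by omega)
    exact_mod_cast (by omega : 2 * ((F.P K).L ^ j + ((F.P K).L ^ j - 1) / 2) ≤ 2 * ((F.P K).L ^ k + ((F.P K).L ^ k - 1) / 2))
  set ρ : ℝ := min ρ₁ ρ₂ with hρ_def
  have hρ : 0 < ρ := lt_min hρ₁ hρ₂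
  obtain ⟨ε, hε, hDε, hDεC⟩ := exists_threshold hC₂ hCp hCΦ0 hρ hD0
  refine ⟨ε, hε, fun M₁ hM1 Z hdiv => ?_⟩
  have h𝔹 : ∀ j, k < j → Bj M₁ Z k j = ∅ := fun j hj => Bj_of_gt hj
  -- (1) per instance: inner sites, hosts; ranks = LEVELS; towers and columns
  let inner : (j : ℕ) → Site (F.P K) j → Prop := fun j y => embIter j y ∈ maxDomT M₁ Z j
  have hhost := fun j => exists_host (inner j) (fun _ : Site (F.P K) j => (0 : ℕ))
  choose hostF hostF_mem hostF_inner _hostF_max using hhost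
  let host : (j : ℕ) → PBond (F.P K) j → Site (F.P K) j := fun j c => hostF j c.src c.tgt
  have host_mem : ∀ j (c : PBond (F.P K) j), host j c = c.src ∨ host j c = c.tgt := fun j c => hostF_mem j c.src c.tgt
  have host_inner : ∀ j (c : PBond (F.P K) j), (inner j c.src ∨ inner j c.tgt) → inner j (host j c) := fun j c h => hostF_inner j c.src c.tgt h
  have host_touch : ∀ j (c : PBond (F.P K) j), c.src = host j c ∨ c.tgt = host j c := fun j c =>
    (host_mem j c).elim (fun h => Or.inl h.symm) (fun h => Or.inr h.symm)
  obtain ⟨rank, hrank⟩ : ∃ rank : Fin (constrCard (Bj M₁ Z k) k) → ℕ, ∀ (j' : ℕ) (hj' : j' < k + 1) (c' : PBond (F.P K) j') (hc' : c' ∈ bondsOf (Bj M₁ Z k j')),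
      rank (constrEnum (Bj M₁ Z k) k ⟨⟨j', hj'⟩, c', hc'⟩) = j' :=
    ⟨fun i => (((constrEnum (Bj M₁ Z k) k).symm i).1 : ℕ), fun j' hj' c' hc' => by simp only [Equiv.symm_apply_apply]⟩
  let tw : ConstrSet (Bj M₁ Z k) k → Set (PBond (F.P K) 0) := fun s =>
    if ((s.1 : ℕ)) = 0 then {b₀ | (⟨(s.1 : ℕ), s.2.1⟩ : (j : ℕ) × PBond (F.P K) j) = ⟨0, b₀⟩} else
      {b₀ | (iterBlockOf (s.1 : ℕ) b₀.src = s.2.1.src ∨ iterBlockOf (s.1 : ℕ) b₀.src = s.2.1.tgt) ∧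
        (iterBlockOf (s.1 : ℕ) b₀.tgt = s.2.1.src ∨ iterBlockOf (s.1 : ℕ) b₀.tgt = s.2.1.tgt)}
  let cl : ConstrSet (Bj M₁ Z k) k → Set (PBond (F.P K) 0) := fun s =>
    if ((s.1 : ℕ)) = 0 then {b₀ | (⟨(s.1 : ℕ), s.2.1⟩ : (j : ℕ) × PBond (F.P K) j) = ⟨0, b₀⟩} else
      {b₀ | iterBlockOf (s.1 : ℕ) b₀.src = host s.1 s.2.1 ∧ iterBlockOf (s.1 : ℕ) b₀.tgt = host s.1 s.2.1 ∧
        iterBlockOf ((s.1 : ℕ) - 1) b₀.src ≠ iterBlockOf ((s.1 : ℕ) - 1) b₀.tgt}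
  obtain ⟨tower, htower⟩ : ∃ tower : Fin (constrCard (Bj M₁ Z k) k) → Set (PBond (F.P K) 0), ∀ (j' : ℕ) (hj' : j' < k + 1) (c' : PBond (F.P K) j')
      (hc' : c' ∈ bondsOf (Bj M₁ Z k j')), tower (constrEnum (Bj M₁ Z k) k ⟨⟨j', hj'⟩, c', hc'⟩) = if j' = 0 then {b₀ | (⟨j', c'⟩ : (j : ℕ) × PBond (F.P K) j) = ⟨0, b₀⟩} else
        {b₀ | (iterBlockOf j' b₀.src = c'.src ∨ iterBlockOf j' b₀.src = c'.tgt) ∧ (iterBlockOf j' b₀.tgt = c'.src ∨ iterBlockOf j' b₀.tgt = c'.tgt)} :=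
    ⟨fun i => tw ((constrEnum (Bj M₁ Z k) k).symm i), fun j' hj' c' hc' => congrArg tw ((constrEnum (Bj M₁ Z k) k).symm_apply_apply ⟨⟨j', hj'⟩, c', hc'⟩)⟩
  obtain ⟨col, hcol⟩ : ∃ col : Fin (constrCard (Bj M₁ Z k) k) → Set (PBond (F.P K) 0), ∀ (j' : ℕ) (hj' : j' < k + 1) (c' : PBond (F.P K) j')
      (hc' : c' ∈ bondsOf (Bj M₁ Z k j')), col (constrEnum (Bj M₁ Z k) k ⟨⟨j', hj'⟩, c', hc'⟩) = if j' = 0 then {b₀ | (⟨j', c'⟩ : (j : ℕ) × PBond (F.P K) j) = ⟨0, b₀⟩} else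
        {b₀ | iterBlockOf j' b₀.src = host j' c' ∧ iterBlockOf j' b₀.tgt = host j' c' ∧ iterBlockOf (j' - 1) b₀.src ≠ iterBlockOf (j' - 1) b₀.tgt} :=
    ⟨fun i => cl ((constrEnum (Bj M₁ Z k) k).symm i), fun j' hj' c' hc' => congrArg cl ((constrEnum (Bj M₁ Z k) k).symm_apply_apply ⟨⟨j', hj'⟩, c', hc'⟩)⟩
  obtain ⟨Λ₀, hΛ₀pos, hΛ₀⟩ := SemilinearMapClass.bound_of_continuous
    (fderiv ℝ (msChart F N K k (Bj M₁ Z k) (avgFamily (avOfRecord F N K) (1 : GaugeField (F.P K) 0 (SU N))) (1 : GaugeField (F.P K) 0 (SU N))) 0)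
    (ContinuousLinearMap.continuous _)
  set Λ : ℝ := Λ₀ + C₁ * ρ₁ * Cp + 1 with hΛ_def
  have hΛ1 : 1 ≤ Λ := by rw [hΛ_def]; nlinarith [mul_nonneg (mul_nonneg hC₁ hρ₁.le) hCp]
  have hΛ0 : 0 ≤ Λ := zero_le_one.trans hΛ1
  set β : ℝ := 1 + 2 * CΦ with hβ_def
  have hβ0 : 0 ≤ β := by rw [hβ_def]; linarith
  have hβ1 : 1 ≤ β := by rw [hβ_def]; linarith
  set Nr : ℕ := k + 1 with hNr_def
  refine ⟨β * Nr * (1 + Λ * β) ^ Nr, mul_nonneg (mul_nonneg hβ0 (Nat.cast_nonneg _)) (pow_nonneg (add_nonneg zero_le_one (mul_nonneg hΛ0 hβ0)) _),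
    fun W U₀ hU hprox hproxSite hplaq => ?_⟩
  have hΨ : DifferentiableAt ℝ (msChart F N K k (Bj M₁ Z k) W U₀) 0 := differentiableAt_msChart_of_towerProxies hk hU hprox
  -- (2) the box gauge at an inner site; the linear map `L = DΨ(0)`, its uniform row bound `Λ`, its row locality
  have hgauge : ∀ (j : ℕ), 1 ≤ j → j ≤ k → ∀ y : Site (F.P K) j, inner j y →
      ∃ u : GaugeTransf (F.P K) 0 (SU N), ∀ (c : PBond (F.P K) j), (c.src = y ∨ c.tgt = y) → ∀ b₀ : PBond (F.P K) 0,
        (iterBlockOf j b₀.src = c.src ∨ iterBlockOf j b₀.src = c.tgt) → (iterBlockOf j b₀.tgt = c.src ∨ iterBlockOf j b₀.tgt = c.tgt) →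
        ‖((GaugeField.gaugeAct u U₀ b₀ : SU N) : Matrix (Fin N) (Fin N) ℂ) - 1‖ ≤ D * ε := by
    intro j hj1 hjk y hy
    obtain ⟨u, hu⟩ := exists_boxGauge (P := F.P K) (N := N) (hjk.trans hk) (three_mul_pow_lt_sitesPerDir hkK hjk) y U₀ hε.le (hplaq j hj1 hjk y hy)
    exact ⟨u, fun c hc b₀ hs ht => (hu b₀ (near_of_endpoint c hc _ hs) (near_of_endpoint c hc _ ht)).trans
      (mul_le_mul_of_nonneg_right (hDj j hjk) hε.le)⟩
  have hDερ₁ : D * ε < ρ₁ := hDε.trans_le (min_le_left _ _)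
  have hDερ₂ : D * ε < ρ₂ := hDε.trans_le (min_le_right _ _)
  have hDε0 : 0 ≤ D * ε := mul_nonneg hD0 hε.le
  set L : (PBond (F.P K) 0 → lieSU (Fin N)) →ₗ[ℝ] (Fin (constrCard (Bj M₁ Z k) k) → lieSU (Fin N)) :=
    (fderiv ℝ (msChart F N K k (Bj M₁ Z k) W U₀) 0).toLinearMap with hL_def
  have hLapp : ∀ x i, L x i = fderiv ℝ (msChart F N K k (Bj M₁ Z k) W U₀) 0 x i := fun _ _ => rfl
  have hrow : ∀ (s : ConstrSet (Bj M₁ Z k) k) (x : PBond (F.P K) 0 → lieSU (Fin N)),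
      ‖fderiv ℝ (msChart F N K k (Bj M₁ Z k) W U₀) 0 x (constrEnum (Bj M₁ Z k) k s)‖ ≤ Λ * ‖x‖ := by
    rintro ⟨⟨j', hj'⟩, c', hc'⟩ x
    have hj'k : j' ≤ k := Nat.lt_succ_iff.1 hj'
    rcases Nat.eq_zero_or_pos j' with rfl | hpos
    · rw [fderiv_msChart_apply_levelZero hU hΨ c' hc' x]
      exact (norm_le_pi_norm x c').trans (le_mul_of_one_le_left (norm_nonneg _) hΛ1)
    · have hin : inner j' (host j' c') := host_inner j' c' (inner_endpoint_of_mem_bondsOf_Bj hpos hj'k hc')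
      obtain ⟨u, hu⟩ := hgauge j' hpos hj'k (host j' c') hin
      have hcy : c'.src = host j' c' ∨ c'.tgt = host j' c' := host_touch j' c'
      have hflat := hu c' hcy
      -- the guarded proxy at the host site, in its own fibre
      obtain ⟨U', hag, hsb'⟩ := hproxSite j' hpos hj'k (host j' c') hin
      have hflat' : ∀ b₀ : PBond (F.P K) 0, (iterBlockOf j' b₀.src = c'.src ∨ iterBlockOf j' b₀.src = c'.tgt) →
          (iterBlockOf j' b₀.tgt = c'.src ∨ iterBlockOf j' b₀.tgt = c'.tgt) →
          ‖((GaugeField.gaugeAct u U' b₀ : SU N) : Matrix (Fin N) (Fin N) ℂ) - 1‖ ≤ D * ε := fun b₀ hs ht => by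
        have e : GaugeField.gaugeAct u U' b₀ = GaugeField.gaugeAct u U₀ b₀ := by
          show u b₀.src * U' b₀ * (u b₀.tgt)⁻¹ = u b₀.src * U₀ b₀ * (u b₀.tgt)⁻¹
          rw [hag c' hcy b₀ hs ht]
        rw [e]; exact hflat b₀ hs ht
      have h := hRB (Bj M₁ Z k) h𝔹 hk (avgFamily (avOfRecord F N K) U') U' (fun _ _ _ => rfl) hsb' (constrEnum (Bj M₁ Z k) k ⟨⟨j', hj'⟩, c', hc'⟩) u hDε0 hDερ₁
      rw [Equiv.symm_apply_apply] at h
      have htr := fderiv_msChart_apply_eq_of_sharpProxy hk hU hΨ hsb' (constrEnum (Bj M₁ Z k) k ⟨⟨j', hj'⟩, c', hc'⟩)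
        (by rw [Equiv.symm_apply_apply]; exact fun b₀ hs ht => hag c' hcy b₀ hs ht) x
      rw [htr]
      refine (h hflat' hΛ₀pos.le hΛ₀ x).trans (mul_le_mul_of_nonneg_right ?_ (norm_nonneg _))
      rw [hΛ_def]
      have : C₁ * (D * ε) * Cp ≤ C₁ * ρ₁ * Cp := mul_le_mul_of_nonneg_right (mul_le_mul_of_nonneg_left hDερ₁.le hC₁) hCp
      linarith
  have hLbound : ∀ x, ‖L x‖ ≤ Λ * ‖x‖ := fun x =>
    (pi_norm_le_iff_of_nonneg (mul_nonneg hΛ0 (norm_nonneg _))).2 fun i => by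
      obtain ⟨s, rfl⟩ := (constrEnum (Bj M₁ Z k) k).surjective i
      rw [hLapp]
      exact hrow s x
  have hNr : ∀ i, rank i < Nr := fun i => by
    obtain ⟨⟨⟨j', hj'⟩, c', hc'⟩, rfl⟩ := (constrEnum (Bj M₁ Z k) k).surjective i
    rw [hrank, hNr_def]
    exact hj'
  have hloc : ∀ (x : PBond (F.P K) 0 → lieSU (Fin N)) (i : Fin (constrCard (Bj M₁ Z k) k)), (∀ b ∈ tower i, x b = 0) → L x i = 0 := by
    intro x i hx
    obtain ⟨⟨⟨j', hj'⟩, c', hc'⟩, rfl⟩ := (constrEnum (Bj M₁ Z k) k).surjective i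
    rw [htower] at hx
    rw [hLapp]
    by_cases h0 : j' = 0
    · subst h0
      rw [if_pos rfl] at hx
      rw [fderiv_msChart_apply_levelZero hU hΨ c' hc' x]
      exact hx c' (by rw [Set.mem_setOf_eq])
    · rw [if_neg h0] at hx
      have key := fderiv_msChart_apply_eq_zero_of_vanish_sharp' hk hΨ x (constrEnum (Bj M₁ Z k) k ⟨⟨j', hj'⟩, c', hc'⟩)
      rw [Equiv.symm_apply_apply] at key
      exact key fun b₀ hs ht => hx b₀ (by rw [Set.mem_setOf_eq]; exact ⟨hs, ht⟩)
  -- (3) rank-wise (= LEVEL-wise) solvability with column supports; the level's direction is the SUM of the site solutions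
  have hinj : ∀ (j : ℕ), j ≤ (F.P K).m + (F.P K).K → ∀ q q' : Site (F.P K) j, embIter j q = embIter j q' → q = q' := fun j hj q q' h => by
    rw [← iterBlockOf_embIter j hj q, h, iterBlockOf_embIter j hj q']
  have hsolv : ∀ (r : ℕ) (v : Fin (constrCard (Bj M₁ Z k) k) → lieSU (Fin N)), (∀ i, rank i ≠ r → v i = 0) →
      ∃ x : PBond (F.P K) 0 → lieSU (Fin N), (∀ i, rank i = r → L x i = v i) ∧ (∀ i, rank i < r → L x i = 0) ∧ ‖x‖ ≤ β * ‖v‖ ∧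
        (∀ b, x b ≠ 0 → ∃ i, rank i = r ∧ v i ≠ 0 ∧ b ∈ col i) := by
    intro r v _hv
    rcases Nat.eq_zero_or_pos r with rfl | hrpos
    · -- rank 0: the level-0 rows, hit by the identity placement
      obtain ⟨x, hx_def, hx_off, hxn⟩ := exists_placement (bondsOf (Bj M₁ Z k 0)) (fun b hb => constrEnum (Bj M₁ Z k) k ⟨⟨0, Nat.succ_pos k⟩, b, hb⟩) v
      refine ⟨x, fun i hi => ?_, fun i hi => absurd hi (Nat.not_lt_zero _), hxn.trans (le_mul_of_one_le_left (norm_nonneg _) hβ1), fun b hb => ?_⟩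
      · obtain ⟨⟨⟨j', hj'⟩, c', hc'⟩, rfl⟩ := (constrEnum (Bj M₁ Z k) k).surjective i
        rw [hrank] at hi
        subst hi
        rw [hLapp, fderiv_msChart_apply_levelZero hU hΨ c' hc' x, hx_def c' hc']
      · have hbm : b ∈ bondsOf (Bj M₁ Z k 0) := by
          by_contra hbm
          exact hb (hx_off b hbm)
        refine ⟨constrEnum (Bj M₁ Z k) k ⟨⟨0, Nat.succ_pos k⟩, b, hbm⟩, hrank 0 _ b hbm, by rwa [hx_def b hbm] at hb, ?_⟩
        rw [hcol, if_pos rfl, Set.mem_setOf_eq]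
    · by_cases hrk : r ≤ k
      · -- rank `n + 1 ≤ k`: the SUM of the curved site blocks at the inner `(n+1)`-sites
        obtain ⟨n, rfl⟩ : ∃ n, r = n + 1 := ⟨r - 1, by omega⟩
        have hn : n + 1 ≤ k := hrk
        have hnK : n + 1 ≤ (F.P K).m + (F.P K).K := hn.trans hk
        -- per-site solutions: the curved block at an inner site on the truncated target hosted there, zero elsewhere
        have hsite : ∀ y : Site (F.P K) (n + 1), ∃ X : PBond (F.P K) 0 → lieSU (Fin N),
            ‖X‖ ≤ 2 * CΦ * ‖v‖ ∧
            (∀ b : PBond (F.P K) 0, X b ≠ 0 → iterBlockOf (n + 1) b.src = y ∧ iterBlockOf (n + 1) b.tgt = y ∧ iterBlockOf n b.src ≠ iterBlockOf n b.tgt ∧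
              ∃ (c : PBond (F.P K) (n + 1)) (hc : c ∈ bondsOf (Bj M₁ Z k (n + 1))), host (n + 1) c = y ∧
                v (constrEnum (Bj M₁ Z k) k ⟨⟨n + 1, Nat.lt_succ_of_le hn⟩, c, hc⟩) ≠ 0) ∧
            (inner (n + 1) y → ∀ (c : PBond (F.P K) (n + 1)) (hc : c ∈ bondsOf (Bj M₁ Z k (n + 1))), (c.src = y ∨ c.tgt = y) →
              L X (constrEnum (Bj M₁ Z k) k ⟨⟨n + 1, Nat.lt_succ_of_le hn⟩, c, hc⟩) =
                if host (n + 1) c = y then v (constrEnum (Bj M₁ Z k) k ⟨⟨n + 1, Nat.lt_succ_of_le hn⟩, c, hc⟩) else 0) ∧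
            (¬ inner (n + 1) y → X = 0) := by
          intro y
          by_cases hy : inner (n + 1) y
          · obtain ⟨hΦQ, hΦsupp⟩ := hΦprops n y hnK
            obtain ⟨u, hu⟩ := hgauge (n + 1) (Nat.succ_pos n) hn y hy
            -- the guarded proxy at the site, in its own fibre; the box gauge is as flat on it
            obtain ⟨U', hag, hsb'⟩ := hproxSite (n + 1) (Nat.succ_pos n) hn y hy
            have hu' : ∀ c : PBond (F.P K) (n + 1), (c.src = y ∨ c.tgt = y) → ∀ b₀ : PBond (F.P K) 0,
                (iterBlockOf (n + 1) b₀.src = c.src ∨ iterBlockOf (n + 1) b₀.src = c.tgt) →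
                (iterBlockOf (n + 1) b₀.tgt = c.src ∨ iterBlockOf (n + 1) b₀.tgt = c.tgt) →
                ‖((GaugeField.gaugeAct u U' b₀ : SU N) : Matrix (Fin N) (Fin N) ℂ) - 1‖ ≤ D * ε := fun c hc b₀ hs ht => by
              have e : GaugeField.gaugeAct u U' b₀ = GaugeField.gaugeAct u U₀ b₀ := by
                show u b₀.src * U' b₀ * (u b₀.tgt)⁻¹ = u b₀.src * U₀ b₀ * (u b₀.tgt)⁻¹
                rw [hag c hc b₀ hs ht]
              rw [e]; exact hu c hc b₀ hs ht
            -- the truncated target hosted at `y`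
            obtain ⟨t, ht_def, htn, ht_ne⟩ := exists_truncTarget (bondsOf (Bj M₁ Z k (n + 1)))
              (fun c hc => constrEnum (Bj M₁ Z k) k ⟨⟨n + 1, Nat.lt_succ_of_le hn⟩, c, hc⟩) (host (n + 1)) y v
            obtain ⟨X, hXrows, hXsupp, hXn⟩ := hblk (Bj M₁ Z k) h𝔹 hk (avgFamily (avOfRecord F N K) U') U' (fun _ _ _ => rfl) hsb' hn y (Φf n y) hCΦ0 hΦQ
              (hCΦfn n (Nat.lt_of_succ_le hn) y) u hDε0 hDερ₂ hDεC hu' t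
            have hXsupp' : ∀ b : PBond (F.P K) 0, X b ≠ 0 →
                iterBlockOf (n + 1) b.src = y ∧ iterBlockOf (n + 1) b.tgt = y ∧ iterBlockOf n b.src ≠ iterBlockOf n b.tgt := fun b hb => by
              obtain ⟨w, hw⟩ := hXsupp b hb
              exact hΦsupp w b hw
            have htne : (∃ b : PBond (F.P K) 0, X b ≠ 0) → t ≠ 0 := by
              rintro ⟨b, hb⟩ rfl
              rw [norm_zero, mul_zero] at hXn
              exact hb (by rw [norm_le_zero_iff.1 hXn]; rfl)
            refine ⟨X, hXn.trans ?_, fun b hb => ?_, fun _ c hc hcy => ?_, fun h => absurd hy h⟩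
            · exact mul_le_mul_of_nonneg_left htn (by positivity)
            · obtain ⟨h1, h2, h3⟩ := hXsupp' b hb
              obtain ⟨c, hc, hhost, hvc⟩ := ht_ne (htne ⟨b, hb⟩)
              exact ⟨h1, h2, h3, c, hc, hhost, hvc⟩
            · rw [hLapp, fderiv_msChart_apply_eq_of_sharpProxy hk hU hΨ hsb' (constrEnum (Bj M₁ Z k) k ⟨⟨n + 1, Nat.lt_succ_of_le hn⟩, c, hc⟩)
                (by rw [Equiv.symm_apply_apply]; exact fun b₀ hs ht => hag c hcy b₀ hs ht) X, hXrows c hc hcy, ht_def c hc]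
          · refine ⟨0, ?_, fun b hb => absurd rfl hb, fun h => absurd h hy, fun _ => rfl⟩
            rw [norm_zero]; positivity
        choose Xs hXsn hXsupp hXrows hXzero using hsite
        set x : PBond (F.P K) 0 → lieSU (Fin N) := ∑ y : Site (F.P K) (n + 1), Xs y with hx_def
        have hx_apply : ∀ b : PBond (F.P K) 0, x b = Xs (iterBlockOf (n + 1) b.src) b := fun b => by
          rw [hx_def]; exact sum_apply_eq_of_support (fun b : PBond (F.P K) 0 => iterBlockOf (n + 1) b.src) Xs (fun y b hb => (hXsupp y b hb).1) b
        -- the footprint of one site solution on the rows of level `≤ n` and on the level-`(n+1)` rows not touching its site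
        have hfoot : ∀ (y : Site (F.P K) (n + 1)) (j' : ℕ) (hj' : j' < k + 1) (c' : PBond (F.P K) j') (hc' : c' ∈ bondsOf (Bj M₁ Z k j')),
            (j' ≤ n ∨ (j' = n + 1 ∧ embIter j' c'.src ≠ embIter (n + 1) y ∧ embIter j' c'.tgt ≠ embIter (n + 1) y)) →
            L (Xs y) (constrEnum (Bj M₁ Z k) k ⟨⟨j', hj'⟩, c', hc'⟩) = 0 := by
          intro y j' hj' c' hc' hjc
          by_cases hy : inner (n + 1) y
          · have hfp := fderiv_msChart_apply_eq_zero_of_siteSupport' (F := F) hM1 hdiv hk hΨ hn hy (Xs y)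
              (fun b hb => ⟨(hXsupp y b hb).1, (hXsupp y b hb).2.1, (hXsupp y b hb).2.2.1⟩) (constrEnum (Bj M₁ Z k) k ⟨⟨j', hj'⟩, c', hc'⟩)
            rw [Equiv.symm_apply_apply] at hfp
            rw [hLapp]
            exact hfp hjc
          · rw [hXzero y hy, map_zero]; rfl
        refine ⟨x, fun i hi => ?_, fun i hi => ?_, ?_, fun b hb => ?_⟩
        · -- rows of rank `n + 1`: exactly the host's block contributes
          obtain ⟨⟨⟨j', hj'⟩, c', hc'⟩, rfl⟩ := (constrEnum (Bj M₁ Z k) k).surjective i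
          rw [hrank] at hi
          subst hi
          have hin : inner (n + 1) (host (n + 1) c') := host_inner _ c' (inner_endpoint_of_mem_bondsOf_Bj (Nat.succ_pos n) hn hc')
          rw [hx_def, map_sum, Finset.sum_apply, Finset.sum_eq_single (host (n + 1) c')]
          · rw [hXrows (host (n + 1) c') hin c' hc' (host_touch _ c'), if_pos rfl]
          · intro y _ hne
            by_cases hy : inner (n + 1) y
            · by_cases hcy : c'.src = y ∨ c'.tgt = y
              · rw [hXrows y hy c' hc' hcy, if_neg (Ne.symm hne)]
              · exact hfoot y (n + 1) hj' c' hc' (Or.inr ⟨rfl, fun hs => hcy (Or.inl (hinj (n + 1) hnK _ _ hs)), fun ht => hcy (Or.inr (hinj (n + 1) hnK _ _ ht))⟩)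
            · rw [hXzero y hy, map_zero]; rfl
          · intro h; exact absurd (Finset.mem_univ _) h
        · -- rows of smaller rank: level `≤ n`, every site solution is invisible
          obtain ⟨⟨⟨j', hj'⟩, c', hc'⟩, rfl⟩ := (constrEnum (Bj M₁ Z k) k).surjective i
          rw [hrank] at hi
          rw [hx_def, map_sum, Finset.sum_apply]
          exact Finset.sum_eq_zero fun y _ => hfoot y j' hj' c' hc' (Or.inl (Nat.lt_succ_iff.1 hi))
        · -- the letter: disjoint supports, so the sup norm of the sum is a sup of the blocks' norms
          refine (pi_norm_le_iff_of_nonneg (mul_nonneg hβ0 (norm_nonneg v))).2 fun b => ?_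
          rw [hx_apply b]
          refine (norm_le_pi_norm _ b).trans ((hXsn _).trans ?_)
          rw [hβ_def]
          nlinarith [norm_nonneg v, hCΦ0]
        · -- the column support
          rw [hx_apply b] at hb
          obtain ⟨h1, h2, h3, c, hc, hhost, hvc⟩ := hXsupp _ b hb
          refine ⟨constrEnum (Bj M₁ Z k) k ⟨⟨n + 1, Nat.lt_succ_of_le hn⟩, c, hc⟩, hrank _ _ c hc, hvc, ?_⟩
          rw [hcol, if_neg (Nat.succ_ne_zero n), Set.mem_setOf_eq, hhost, Nat.add_sub_cancel]
          exact ⟨h1, h2, h3⟩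
      · -- no row has rank `r > k`: `x = 0`
        refine ⟨0, fun i hi => ?_, fun i _ => by rw [map_zero]; rfl, by rw [norm_zero]; exact mul_nonneg hβ0 (norm_nonneg _),
          fun b hb => absurd rfl hb⟩
        exfalso
        obtain ⟨⟨⟨j', hj'⟩, c', hc'⟩, rfl⟩ := (constrEnum (Bj M₁ Z k) k).surjective i
        rw [hrank] at hi
        omega
  -- (4) back-substitution with supports, the norm conversion, and the support clause in the record's vocabulary
  obtain ⟨H, hHinv, hHB, hHS⟩ := exists_rightInverse_bound_support_of_rankwise L rank hNr tower col hβ0 hΛ0 hLbound hloc hsolv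
  refine ⟨H, fun v => ?_, hHB, fun v => ?_, fun v 𝒮 hzero hpos b hb => ?_⟩
  · have h := hHinv v
    rwa [hL_def, ContinuousLinearMap.coe_coe] at h
  · refine (sqrt_sum_sq_le (H v)).trans ?_
    rw [mul_assoc]; exact mul_le_mul_of_nonneg_left (hHB v) (Real.sqrt_nonneg _)
  · refine hHS v 𝒮 (fun i hi => ?_) b hb
    obtain ⟨⟨⟨j', hj'⟩, c', hc'⟩, rfl⟩ := (constrEnum (Bj M₁ Z k) k).surjective i
    rw [htower, hrank] at hi
    rw [hcol, hrank]
    by_cases h0 : j' = 0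
    · subst h0
      rw [if_pos rfl] at hi
      rw [if_pos rfl]
      intro b₀ hb₀
      rw [Set.mem_setOf_eq, sigma_mk_zero_eq_iff] at hb₀
      subst hb₀
      rcases hi with hv | ⟨m, hm, _⟩
      · exact hzero c' hc' hv
      · exact absurd hm (Nat.not_lt_zero m)
    · have hj1 : 1 ≤ j' := Nat.one_le_iff_ne_zero.2 h0
      have hj'k : j' ≤ k := Nat.lt_succ_iff.1 hj'
      rw [if_neg h0] at hi
      rw [if_neg h0]
      intro b₀ hb₀
      rw [Set.mem_setOf_eq] at hb₀
      obtain ⟨hs, ht, hface⟩ := hb₀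
      have hin : inner j' (host j' c') := host_inner j' c' (inner_endpoint_of_mem_bondsOf_Bj hj1 hj'k hc')
      have hi' : v (constrEnum (Bj M₁ Z k) k ⟨⟨j', Nat.lt_succ_of_le hj'k⟩, c', hc'⟩) ≠ 0 ∨
          ∃ m, m < j' ∧ ∃ b₁ ∈ 𝒮 m, (iterBlockOf j' b₁.src = c'.src ∨ iterBlockOf j' b₁.src = c'.tgt) ∧ (iterBlockOf j' b₁.tgt = c'.src ∨ iterBlockOf j' b₁.tgt = c'.tgt) := by
        rcases hi with hv | ⟨m, hm, b₁, hb₁S, hb₁t⟩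
        · exact Or.inl hv
        · exact Or.inr ⟨m, hm, b₁, hb₁S, by rwa [Set.mem_setOf_eq] at hb₁t⟩
      exact hpos j' hj1 hj'k c' hc' hi' (host j' c') (host_touch j' c') hin b₀ hs ht hface

end Record

end Summit.QuantumFields.YangMills.BalabanUVNodes.N12DirectSurjHsurjSupport

end
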